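import Summits.KontsevichZagierPeriods.KontsevichZagierPeriods.Theorems.FurushoPentagonStuffleInKZDefs
import Summits.KontsevichZagierPeriods.KontsevichZagierPeriods.Theorems.FurushoPentagonHoffmanRelationInKZCubicalTransportAux2
import Literature.NumberTheory.Transcendental.KZProductIdeal

/-!
# `StuffleInKZ` (stmt-KontsevichZagierPeriods-3931), line `cumulative-cube-lattice-paths`:
# the cube chart (stubs `stub_chartCalculus`, `stub_cubeChart`)

The two chart stubs of the line, discharged from the monomial-chart toolkit that the sibling line
`dilation-homotopy-transposition` of `HoffmanRelationInKZ` landed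
(`FurushoPentagonHoffmanRelationInKZCubicalTransportAux{,2}.lean`: derivative and triangular
Jacobian of a monomial chart, injectivity and image of the cubical chart `tᵢ = x₀⋯xᵢ`, the
letterwise pull-back identity `stub_cubicalPullback`, and the one-move transport
`monomialChart_transport`). What is added here is bookkeeping: the rows `{j ≤ i}` of
`StuffleInKZ.chart` versus `{j < i+1}`, and the list form `cubeKernel u (List.ofFn x)` of the cubical
integrand versus the `Fin`-product form (`List.prod_take_ofFn`).

References: M. Kontsevich, D. Zagier, *Periods* (2001), §1.2 rule (2); I. Soudères, *Motivic double
shuffle*, IJNT 6 (2010), §1.3.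
-/

noncomputable section

open Set MeasureTheory
open Literature.NumberTheory.Transcendental
open Literature.NumberTheory.Transcendental.KZ
open Literature.NumberTheory.Transcendental.MZV (IsAdmissible weight)
open Summit.KontsevichZagierPeriods.FurushoPentagon.HoffmanRelationInKZ (monomialChart_transport
  hasFDerivAt_monomialChart det_monomialChart cubicalChart_apply cubicalChart_diag cubicalChart_rows
  injOn_cubicalChart image_cubicalChart partialProd_pos_le stub_cubicalPullback)

namespace Summit.KontsevichZagierPeriods.FurushoPentagon.StuffleInKZ

/-! ### Rows `{j ≤ i}` versus `{j < i + 1}` -/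

/-- The rows of `chart`: `{j | j ≤ i} = {j | j < i + 1}` in `Fin w`. [folklore] -/
theorem filter_le_eq_filter_lt_succ (w : ℕ) (i : Fin w) :
    Finset.univ.filter (fun j : Fin w => j ≤ i) =
      Finset.univ.filter (fun j : Fin w => (j : ℕ) < (i : ℕ) + 1) := by
  ext j
  simp only [Finset.mem_filter, Finset.mem_univ, true_and, Fin.le_def]
  omega

/-- `chart w` is the cubical chart `x ↦ (∏_{j < i+1} x_j)_i`. [folklore] -/
theorem chart_eq (w : ℕ) : chart w = fun (x : Fin w → ℝ) (i : Fin w) =>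
    ∏ j ∈ Finset.univ.filter (fun j : Fin w => (j : ℕ) < (i : ℕ) + 1), x j := by
  funext x i
  rw [chart_apply, filter_le_eq_filter_lt_succ]

/-- The off-diagonal part of the row `{j ≤ i}` is `{j < i}`. [folklore] -/
theorem filter_le_erase (w : ℕ) (i : Fin w) :
    (Finset.univ.filter (fun j : Fin w => j ≤ i)).erase i =
      Finset.univ.filter (fun j : Fin w => j < i) := by
  ext j
  simp only [Finset.mem_erase, Finset.mem_filter, Finset.mem_univ, true_and]
  constructor
  · rintro ⟨hne, hle⟩; exact lt_of_le_of_ne hle hne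
  · intro hlt; exact ⟨hlt.ne, hlt.le⟩

/-! ### The calculus of the chart -/

/-- **Stub `stub_chartCalculus`** of the line: the cumulative-product chart is injective on the open
cube, maps it onto Kontsevich's open ordered simplex, and has at every point of the cube a Fréchet
derivative of determinant `∏ᵢ ∏_{j<i} x_j` (lower-triangular Jacobian). [cite: Souderes2010, §1.3] -/
theorem stub_chartCalculus : ∀ w : ℕ,
    Set.InjOn (chart w) (openCube w) ∧
    chart w '' openCube w = openOrderedSimplex w ∧
    ∀ x ∈ openCube w, ∃ Φ' : (Fin w → ℝ) →L[ℝ] (Fin w → ℝ),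
      HasFDerivAt (chart w) Φ' x ∧
        Φ'.det = ∏ i : Fin w, ∏ j ∈ Finset.univ.filter (fun j : Fin w => j < i), x j := by
  intro w
  set T : ℕ → (Fin w → ℝ) → ℝ := fun m x => ∏ j : Fin w, if (j : ℕ) < m then x j else 1 with hT_def
  have hT : ∀ m x, T m x = ∏ j : Fin w, if (j : ℕ) < m then x j else 1 := fun _ _ => rfl
  have hΦ : ∀ (x : Fin w → ℝ) (i : Fin w), chart w x i =
      ∏ j ∈ Finset.univ.filter (fun j : Fin w => (j : ℕ) < (i : ℕ) + 1), x j := by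
    intro x i; rw [chart_eq]
  refine ⟨?_, ?_, ?_⟩
  · exact injOn_cubicalChart T hT (chart w) hΦ
  · exact image_cubicalChart T hT (chart w) hΦ
  · intro x _
    refine ⟨ContinuousLinearMap.pi fun i : Fin w =>
        ∑ j ∈ Finset.univ.filter (fun j : Fin w => j ≤ i),
          (∏ k ∈ (Finset.univ.filter (fun j : Fin w => j ≤ i)).erase j, x k) •
            ContinuousLinearMap.proj (R := ℝ) (φ := fun _ : Fin w => ℝ) j, ?_, ?_⟩
    · exact hasFDerivAt_monomialChart (fun i : Fin w => Finset.univ.filter (fun j : Fin w => j ≤ i)) x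
    · rw [det_monomialChart (fun i : Fin w => Finset.univ.filter (fun j : Fin w => j ≤ i))
        (fun i j hj => (Finset.mem_filter.mp hj).2) (fun i => by simp)]
      exact Finset.prod_congr rfl fun i _ => by rw [filter_le_erase]

/-! ### The cube chart -/

/-- The list form of the partial products: `((List.ofFn x).take m).prod = T m x`. [folklore] -/
theorem prod_take_ofFn_eq {w : ℕ} (x : Fin w → ℝ) (m : ℕ) :
    ((List.ofFn x).take m).prod = ∏ j : Fin w, if (j : ℕ) < m then x j else 1 := by
  rw [List.prod_take_ofFn, Finset.prod_filter]

/-- The cube kernel in `Fin`-product form: for `x ∈ ℝʷ`, `w = weight u`,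
`cubeKernel u (List.ofFn x) = ∏_{l < |u|} T_{p_l} x / (1 − T_{p_{l+1}} x)`. [folklore] -/
theorem cubeKernel_ofFn (u : List ℕ) (x : Fin (weight u) → ℝ) :
    cubeKernel u (List.ofFn x) = ∏ l : Fin u.length,
      (∏ j : Fin (weight u), if (j : ℕ) < (u.take l).sum then x j else 1) /
        (1 - ∏ j : Fin (weight u), if (j : ℕ) < (u.take ((l : ℕ) + 1)).sum then x j else 1) := by
  rw [cubeKernel_def, ← Fin.prod_univ_eq_prod_range]
  simp only [prod_take_ofFn_eq]

/-- **Stub `stub_cubeChart`** of the line (the lead's): for every non-empty admissible `u` the cube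
representation `[(0,1)^{|u|}, cubeKernel u]` exists and every representation of that shape is
KZ-equivalent to Kontsevich's simplex representation `KZ.mzvRep u`, by ONE change of variables along
the cumulative-product chart (`monomialChart_transport` fed with `stub_cubicalPullback`). The
hypothesis (the calculus of `chart`) is part of the registered signature; the proof re-derives what
it needs from the monomial-chart toolkit. [cite: KontsevichZagier2001, §1.2 rule (2)] -/
theorem stub_cubeChart :
    (∀ w : ℕ, Set.InjOn (chart w) (openCube w) ∧ chart w '' openCube w = openOrderedSimplex w ∧
      ∀ x ∈ openCube w, ∃ Φ' : (Fin w → ℝ) →L[ℝ] (Fin w → ℝ), HasFDerivAt (chart w) Φ' x ∧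
        Φ'.det = ∏ i : Fin w, ∏ j ∈ Finset.univ.filter (fun j : Fin w => j < i), x j) →
    ∀ (u : List ℕ) (hu : IsAdmissible u), u ≠ [] →
      (∃ C : IntegralRep (weight u), C.domain = openCube (weight u) ∧
        Set.EqOn C.integrand (fun x => cubeKernel u (List.ofFn x)) C.domain) ∧
      ∀ C : IntegralRep (weight u), C.domain = openCube (weight u) →
        Set.EqOn C.integrand (fun x => cubeKernel u (List.ofFn x)) C.domain →
        Equivalent (mzvRep u hu (mzvIntegrand_isSemialgebraicFunOn_holds u)
          (mzvIntegrand_integrableOn_holds u hu)) C := by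
  intro _ u hu _
  set w := weight u with hw
  -- the cubical chart in the sibling line's normal form
  set T : ℕ → (Fin w → ℝ) → ℝ := fun m x => ∏ j : Fin w, if (j : ℕ) < m then x j else 1 with hT_def
  have hT : ∀ m x, T m x = ∏ j : Fin w, if (j : ℕ) < m then x j else 1 := fun _ _ => rfl
  set S : Fin w → Finset (Fin w) := fun i => Finset.univ.filter (fun j : Fin w => (j : ℕ) < (i : ℕ) + 1)
    with hS_def
  set Φ : (Fin w → ℝ) → (Fin w → ℝ) := fun x i => ∏ j ∈ S i, x j with hΦ_def
  have hΦ : ∀ x i, Φ x i = ∏ j ∈ Finset.univ.filter (fun j : Fin w => (j : ℕ) < (i : ℕ) + 1), x j :=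
    fun _ _ => rfl
  obtain ⟨hS, hS'⟩ := cubicalChart_rows w
  have hinj : InjOn Φ (openCube w) := injOn_cubicalChart T hT Φ hΦ
  have himg : Φ '' openCube w = openOrderedSimplex w := image_cubicalChart T hT Φ hΦ
  have hD : Literature.ModelTheory.ExponentialFields.IsSemialgebraic ℚ (openCube w) := by
    have : openCube w = ⋂ i ∈ (Finset.univ : Finset (Fin w)),
        ({x : Fin w → ℝ | 0 < MvPolynomial.aeval x (MvPolynomial.X i : MvPolynomial (Fin w) ℚ)} ∩
          {x | 0 < MvPolynomial.aeval x (1 - MvPolynomial.X i : MvPolynomial (Fin w) ℚ)}) := by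
      ext x
      simp [mem_openCube, Set.mem_Ioo, sub_pos]
    rw [this]
    exact Literature.ModelTheory.ExponentialFields.IsSemialgebraic.biInter _ _ fun i _ =>
      (Literature.ModelTheory.ExponentialFields.isSemialgebraic_setOf_eval_pos (k := ℚ) _).inter
        (Literature.ModelTheory.ExponentialFields.isSemialgebraic_setOf_eval_pos (k := ℚ) _)
  -- the pull-back identity in list form
  have hgh : ∀ x ∈ openCube w, cubeKernel u (List.ofFn x) =
      mzvIntegrand u (Φ x) * |∏ i, ∏ k ∈ (S i).erase i, x k| := by
    intro x hx
    have hx' : ∀ i, x i ∈ Ioo (0 : ℝ) 1 := hx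
    have hdiag : ∀ i, ∏ k ∈ (S i).erase i, x k = T i x := fun i => cubicalChart_diag T hT x i
    have hpos : 0 < ∏ i : Fin w, T i x :=
      Finset.prod_pos fun i _ => (partialProd_pos_le T hT hx' i).1
    have hΦx : Φ x = fun i : Fin w => T ((i : ℕ) + 1) x :=
      funext fun i => cubicalChart_apply T hT Φ hΦ x i
    simp only [hdiag]
    rw [abs_of_pos hpos, hΦx, stub_cubicalPullback u hu.1 T hT x fun i => (hx' i).1.ne',
      cubeKernel_ofFn]
  obtain ⟨hex, heq⟩ := monomialChart_transport S hS hS' hD Φ (fun _ _ => rfl) hinj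
    (fun x => cubeKernel u (List.ofFn x)) (mzvIntegrand u) hgh
  have hΔd : (mzvRep u hu (mzvIntegrand_isSemialgebraicFunOn_holds u)
      (mzvIntegrand_integrableOn_holds u hu)).domain = Φ '' openCube w := by
    rw [mzvRep_domain, himg]
  have hΔi : EqOn (mzvRep u hu (mzvIntegrand_isSemialgebraicFunOn_holds u)
      (mzvIntegrand_integrableOn_holds u hu)).integrand (mzvIntegrand u)
      (mzvRep u hu (mzvIntegrand_isSemialgebraicFunOn_holds u)
        (mzvIntegrand_integrableOn_holds u hu)).domain := fun _ _ => rfl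
  refine ⟨?_, fun C hCd hCi => ?_⟩
  · obtain ⟨C, hCd, hCi⟩ := hex _ hΔd hΔi
    exact ⟨C, hCd, fun x _ => by rw [hCi]⟩
  · exact (heq C _ hCd (fun x hx => hCi (hCd.symm ▸ hx)) hΔd hΔi).symm

end Summit.KontsevichZagierPeriods.FurushoPentagon.StuffleInKZ
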